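import Summits.AtomisticToContinuum.HydrodynamicLimit.Theorems.JParityClosureLocalSecondLawKineticStressStrain
import Literature.Analysis.FluidPDE.HardSphereTrajectoryMeasurable

/-!
# `T₁` is an honest Bochner integral on the regular event; the deterministic core of P1
(stmt-AtomisticToContinuum-13081, line `exact-entropy-ledger-three-passivities`; support of the stubs
`stub_passivityKinetic` (P1) and `stub_ledger` (L); file 3 of 3 of the kinetic-stress regularity package)

1. JUNK AUDIT OF `T₁ = −∫₀^τ∫ (φ/θ_r) Σ^dev_r : ∇u_r`, made formal: **on the regular event both Bochner integrals of
   `T₁` are honest** (`T1_honest_of_regular`).  For `0 < r`, `0 < c`, a smooth test function and `z ∈ Regular`: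
   the space integrand is Borel and bounded on `𝕋³` at every `s ∈ [0,τ]` (floors, `|Σ^dev| ≤ 8ke/(πr³)`, strain
   bound and measurability of file 2), hence integrable (`psvK_integrable_T₁_inner`); along the good orbit — Borel in
   time (`IsHardSphereTrajectory.measurable_torus`), energy conserved (`ke_flow_eq`) — its space integral is a bounded
   Borel function of `s` (Fubini measurability `StronglyMeasurable.integral_prod_right'` of the jointly Borel FLOORED
   integrand, which agrees with the true one on `[0,τ]`), hence integrable on `[0,τ]` (`psvK_integrableOn_T₁_outer`).
   No junk value is taken anywhere on `Regular`: the stub P1 has no trivial part — as registered (unconditional,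
   all `τ`) it is the open local-Maxwellisation statement (⟸ OddContactSymmetry + RateFloor + ParityRigidity +
   KineticEnergyTails pre-shock; a bet post-shock).  The same holds for the `L¹` majorant `∫₀^τ∫∑ₖₗ|Σ^dev_{kl}|`
   (`psvK_integrableOn_absDev`).
2. THE DETERMINISTIC CORE OF P1 (`abs_T1_le_of_regular`): on a regular orbit with weight bound `|φ| ≤ M` and
   strain bound `r|∂ₖu_{r,l}| ≤ K` on `[0,τ] × 𝕋³`, `|T₁| ≤ (MK/(cr)) ∫₀^τ∫ ∑ₖₗ|Σ^dev_{kl}|` — only the MAJORANT needs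
   honest integrals (`norm_integral_le_of_norm_le` at both levels).  It is the lever of the conditional form
   "kinetic `L¹`-isotropy at rate `r` + strain tightness at rate `1/r` ⇒ P1"
   (`Theorems/JParityClosureLocalSecondLawPassivityKineticOfIsotropy.lean`).

References: H. Spohn, *Large Scale Dynamics of Interacting Particles* (1991), Part I §3 (setting);
J. H. Irving, J. G. Kirkwood, J. Chem. Phys. 18 (1950) 817.
-/

noncomputable section

namespace Summit.AtomisticToContinuum.HydrodynamicLimit.Theorems.LocalSecondLawLedger

open scoped BigOperators Topology Classical MeasureTheory ENNReal InnerProductSpace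
open Filter Set MeasureTheory
open Literature.MathematicalPhysics.KineticTheory
open Literature.Analysis.FluidPDE
open Summit.AtomisticToContinuum.HydrodynamicLimit.Theorems.LocalSecondLawNegative

variable {N : ℕ}

/-! ## (a) Honesty of `T₁` on the regular event

On the regular event both Bochner integrals of `T₁` are honest: the space integrand is Borel and bounded for
every configuration on the floors `c ≤ ρ_r`, `c ≤ θ_r` (the strain through `uFloor` and
`measurable_deriv_with_param`, bounded by the Lipschitz strain constant), and its space integral is a
bounded Borel function of time along a good orbit (the orbit is Borel in time,
`IsHardSphereTrajectory.measurable_torus`; Fubini measurability `StronglyMeasurable.integral_prod_right'`). -/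

/-- Pointwise bound of the `T₁` integrand on the floors: with `|a| ≤ Ca`, `c ≤ ρ_r` everywhere and `c ≤ θ_r(x)`,
`|a/θ_r(x) · ∑ₖₗ Σ^dev_{kl}(x) ∂ₖu_{r,l}(x)| ≤ (Ca/c) · 9 · (8 ke/(πr³)) · K(r, c, ke)`. -/
theorem psvK_abs_T₁_integrand_le {r c : ℝ} (hr : 0 < r) (hc : 0 < c) {w : Phase N} {x : T3}
    (hρ : ∀ y, c ≤ rhoC r w y) (hθ : c ≤ thetaC r w x) {a Ca : ℝ} (ha : |a| ≤ Ca) :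
    |a / thetaC r w x * ∑ k : Fin 3, ∑ l : Fin 3, devC r w x k l * pD k (fun y => uC r w y l) x| ≤
      Ca / c * (9 * (8 / (Real.pi * r ^ 3) * ke w * (3 / (Real.pi * r ^ 4) * (1 / 2 + ke w) / c + 3 / (Real.pi * r ^ 3) * (1 / 2 + ke w) * (3 / (Real.pi * r ^ 4)) / c ^ 2))) := by
  have hθpos : 0 < thetaC r w x := lt_of_lt_of_le hc hθ
  have hCa : 0 ≤ Ca := (abs_nonneg _).trans ha
  have h1 : |a / thetaC r w x| ≤ Ca / c := by
    rw [abs_div, abs_of_pos hθpos]; exact div_le_div₀ hCa ha hc hθ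
  have hD : ∀ k l, |devC r w x k l * pD k (fun y => uC r w y l) x| ≤
      8 / (Real.pi * r ^ 3) * ke w * (3 / (Real.pi * r ^ 4) * (1 / 2 + ke w) / c + 3 / (Real.pi * r ^ 3) * (1 / 2 + ke w) * (3 / (Real.pi * r ^ 4)) / c ^ 2) := fun k l => by
    rw [abs_mul]
    exact mul_le_mul (psvK_abs_devC_le_ke hr w x k l) (psvK_abs_pD_uC_le hr hc hρ x k l)
      (abs_nonneg _) (mul_nonneg (by positivity) (ke_nonneg w))
  have h2 : |∑ k : Fin 3, ∑ l : Fin 3, devC r w x k l * pD k (fun y => uC r w y l) x| ≤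
      9 * (8 / (Real.pi * r ^ 3) * ke w * (3 / (Real.pi * r ^ 4) * (1 / 2 + ke w) / c + 3 / (Real.pi * r ^ 3) * (1 / 2 + ke w) * (3 / (Real.pi * r ^ 4)) / c ^ 2)) := by
    calc _ ≤ ∑ k : Fin 3, |∑ l : Fin 3, devC r w x k l * pD k (fun y => uC r w y l) x| :=
          Finset.abs_sum_le_sum_abs _ _
      _ ≤ ∑ k : Fin 3, ∑ l : Fin 3, |devC r w x k l * pD k (fun y => uC r w y l) x| :=
          Finset.sum_le_sum fun k _ => Finset.abs_sum_le_sum_abs _ _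
      _ ≤ ∑ _k : Fin 3, ∑ _l : Fin 3, 8 / (Real.pi * r ^ 3) * ke w * (3 / (Real.pi * r ^ 4) * (1 / 2 + ke w) / c + 3 / (Real.pi * r ^ 3) * (1 / 2 + ke w) * (3 / (Real.pi * r ^ 4)) / c ^ 2) :=
          Finset.sum_le_sum fun k _ => Finset.sum_le_sum fun l _ => hD k l
      _ = 9 * (8 / (Real.pi * r ^ 3) * ke w * (3 / (Real.pi * r ^ 4) * (1 / 2 + ke w) / c + 3 / (Real.pi * r ^ 3) * (1 / 2 + ke w) * (3 / (Real.pi * r ^ 4)) / c ^ 2)) := by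
          simp only [Finset.sum_const, Finset.card_univ, Fintype.card_fin, nsmul_eq_mul, Nat.cast_ofNat]
          ring
  rw [abs_mul]
  exact mul_le_mul h1 h2 (abs_nonneg _) (div_nonneg hCa hc.le)

/-- **The space integrand of `T₁` is Bochner integrable on the floors** (`integrable_T₁_inner`).  For `0 < r`,
`0 < c`, a configuration with `c ≤ ρ_r` and `c ≤ θ_r` everywhere and a continuous weight `ψ`,
`x ↦ ψ x / θ_r(x) · ∑ₖₗ Σ^dev_{kl}(x) ∂ₖu_{r,l}(x)` is Borel and bounded on `𝕋³`, hence integrable. -/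
theorem psvK_integrable_T₁_inner {r c : ℝ} (hr : 0 < r) (hc : 0 < c) {w : Phase N}
    (hρ : ∀ y, c ≤ rhoC r w y) (hθ : ∀ y, c ≤ thetaC r w y) {ψ : T3 → ℝ} (hψ : Continuous ψ) :
    Integrable (fun x => ψ x / thetaC r w x *
      ∑ k : Fin 3, ∑ l : Fin 3, devC r w x k l * pD k (fun y => uC r w y l) x) := by
  -- measurability (compositions are pre-built without expected type: cheap first-order defeq only)
  have hmθ := (psvK_measurable_thetaC_uncurry (N := N) r).fun_comp (measurable_prodMk_left (x := w))
  have hmdev := fun k l =>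
    (psvK_measurable_devC_uncurry (N := N) r k l).fun_comp (measurable_prodMk_left (x := w))
  have hmpD' := fun k l =>
    (psvK_measurable_pD_uFloor (N := N) hc r k l).fun_comp (measurable_prodMk_left (x := w))
  have hmpD : ∀ k l, Measurable fun x => pD k (fun y => uC r w y l) x := by
    intro k l
    rw [← psvK_uFloor_eq_uC hρ l]
    exact hmpD' k l
  have hmeas : Measurable fun x => ψ x / thetaC r w x *
      ∑ k : Fin 3, ∑ l : Fin 3, devC r w x k l * pD k (fun y => uC r w y l) x :=
    (hψ.measurable.div hmθ).mul (Finset.measurable_sum _ fun k _ =>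
      Finset.measurable_sum _ fun l _ => (hmdev k l).mul (hmpD k l))
  -- bound
  obtain ⟨Cψ, hCψ⟩ := isCompact_univ.exists_bound_of_continuousOn hψ.continuousOn
  refine Integrable.mono' (integrable_const (Cψ / c *
      (9 * (8 / (Real.pi * r ^ 3) * ke w * (3 / (Real.pi * r ^ 4) * (1 / 2 + ke w) / c + 3 / (Real.pi * r ^ 3) * (1 / 2 + ke w) * (3 / (Real.pi * r ^ 4)) / c ^ 2)))))
    hmeas.aestronglyMeasurable (Eventually.of_forall fun x => ?_)
  rw [Real.norm_eq_abs]
  have hx : |ψ x| ≤ Cψ := by rw [← Real.norm_eq_abs]; exact hCψ x (Set.mem_univ x)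
  exact psvK_abs_T₁_integrand_le hr hc hρ (hθ x) hx

/-- The space–time majorant `∑ₖₗ |Σ^dev_{kl}|` composed with a good orbit is jointly Borel in `(s, x)`. -/
theorem psvK_measurable_absDev_orbit (r : ℝ) {σ : ℝ} (Φ : Flow σ N) {z : Phase N} (hz : z ∈ Φ.good) :
    Measurable fun q : ℝ × T3 => ∑ k : Fin 3, ∑ l : Fin 3, |devC r (Φ.flow q.1 z) q.2 k l| := by
  have hγ : Measurable fun s => Φ.flow s z :=
    IsHardSphereTrajectory.measurable_torus (Φ.isTrajectory z hz)
  have hwx : Measurable fun q : ℝ × T3 => ((Φ.flow q.1 z, q.2) : Phase N × T3) :=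
    (hγ.fun_comp measurable_fst).prodMk measurable_snd
  have hdev := fun k l => (psvK_measurable_devC_uncurry (N := N) r k l).fun_comp hwx
  exact Finset.measurable_sum _ fun k _ => Finset.measurable_sum _ fun l _ => (hdev k l).abs

/-- **The `L¹` majorant `s ↦ ∫ ∑ₖₗ |Σ^dev_{kl}|(Φₛz, x) dx` is integrable on `[0, τ]` along a good orbit**
(`0 < r`): Borel by Fubini measurability, bounded by `72 ke(z)/(πr³)` by energy conservation. -/
theorem psvK_integrableOn_absDev {σ r τ : ℝ} (hr : 0 < r) (Φ : Flow σ N) {z : Phase N} (hz : z ∈ Φ.good) :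
    IntegrableOn (fun s => ∫ x : T3, ∑ k : Fin 3, ∑ l : Fin 3, |devC r (Φ.flow s z) x k l|)
      (Set.Icc (0 : ℝ) τ) := by
  have hGm : StronglyMeasurable fun s => ∫ x : T3,
      ∑ k : Fin 3, ∑ l : Fin 3, |devC r (Φ.flow s z) x k l| :=
    (psvK_measurable_absDev_orbit (N := N) r Φ hz).stronglyMeasurable.integral_prod_right'
  have hpt : ∀ s x, |(∑ k : Fin 3, ∑ l : Fin 3, |devC r (Φ.flow s z) x k l|)| ≤
      9 * (8 / (Real.pi * r ^ 3) * ke z) := by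
    intro s x
    rw [abs_of_nonneg (Finset.sum_nonneg fun k _ => Finset.sum_nonneg fun l _ => abs_nonneg _),
      ← ke_flow_eq Φ hz s]
    calc _ ≤ ∑ _k : Fin 3, ∑ _l : Fin 3, 8 / (Real.pi * r ^ 3) * ke (Φ.flow s z) :=
          Finset.sum_le_sum fun k _ => Finset.sum_le_sum fun l _ => psvK_abs_devC_le_ke hr _ x k l
      _ = _ := by
          simp only [Finset.sum_const, Finset.card_univ, Fintype.card_fin, nsmul_eq_mul, Nat.cast_ofNat]
          ring
  have hbound : ∀ s, ‖∫ x : T3, ∑ k : Fin 3, ∑ l : Fin 3, |devC r (Φ.flow s z) x k l|‖ ≤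
      9 * (8 / (Real.pi * r ^ 3) * ke z) := by
    intro s
    refine (norm_integral_le_of_norm_le_const (C := 9 * (8 / (Real.pi * r ^ 3) * ke z))
      (Eventually.of_forall fun x => ?_)).trans ?_
    · rw [Real.norm_eq_abs]; exact hpt s x
    · simp
  exact Measure.integrableOn_of_bounded measure_Icc_lt_top.ne hGm.aestronglyMeasurable
    (Eventually.of_forall hbound)

/-- **The time integrand of `T₁` is integrable on `[0, τ]` on the regular event** (`integrableOn_T₁_outer`).
For a Borel weight `φ` bounded on `[0,τ] × 𝕋³`, the function `s ↦ ∫ φ/θ_r · Σ^dev_r : ∇u_r dx` (fields read at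
`Φₛ z`) is Borel on `[0, τ]` — it agrees there with the space integral of the jointly Borel floored integrand — and
bounded, by the floors, `|Σ^dev| ≤ 8ke/(πr³)`, `|∂u_r| ≤ K(r,c,ke)` and energy conservation. -/
theorem psvK_integrableOn_T₁_outer {σ r τ c η₁ : ℝ} (hr : 0 < r) (hc : 0 < c) {Φ : Flow σ N}
    {z : Phase N} (hz : Regular σ r τ c η₁ Φ z) {φ : ℝ → T3 → ℝ}
    (hφm : Measurable (Function.uncurry φ)) {Cφ : ℝ} (hφb : ∀ s ∈ Set.Icc (0 : ℝ) τ, ∀ x, |φ s x| ≤ Cφ) :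
    IntegrableOn (fun s => ∫ x : T3, φ s x / thetaC r (Φ.flow s z) x *
      ∑ k : Fin 3, ∑ l : Fin 3, devC r (Φ.flow s z) x k l * pD k (fun y => uC r (Φ.flow s z) y l) x)
      (Set.Icc (0 : ℝ) τ) := by
  have hγ : Measurable fun s => Φ.flow s z :=
    IsHardSphereTrajectory.measurable_torus (Φ.isTrajectory z hz.1)
  have hwx : Measurable fun q : ℝ × T3 => ((Φ.flow q.1 z, q.2) : Phase N × T3) :=
    (hγ.fun_comp measurable_fst).prodMk measurable_snd
  -- the honest (floored) space–time integrand is jointly Borel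
  have hθm := (psvK_measurable_thetaC_uncurry (N := N) r).fun_comp hwx
  have hdevm := fun k l => (psvK_measurable_devC_uncurry (N := N) r k l).fun_comp hwx
  have hpDm := fun k l => (psvK_measurable_pD_uFloor (N := N) hc r k l).fun_comp hwx
  have hFm : Measurable fun q : ℝ × T3 => φ q.1 q.2 / thetaC r (Φ.flow q.1 z) q.2 *
      ∑ k : Fin 3, ∑ l : Fin 3, devC r (Φ.flow q.1 z) q.2 k l *
        pD k (fun y => (max (rhoC r (Φ.flow q.1 z) y) c)⁻¹ * momC r (Φ.flow q.1 z) y l) q.2 :=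
    (hφm.div hθm).mul (Finset.measurable_sum _ fun k _ => Finset.measurable_sum _ fun l _ =>
      (hdevm k l).mul (hpDm k l))
  have hGm : StronglyMeasurable fun s => ∫ x : T3, φ s x / thetaC r (Φ.flow s z) x *
      ∑ k : Fin 3, ∑ l : Fin 3, devC r (Φ.flow s z) x k l *
        pD k (fun y => (max (rhoC r (Φ.flow s z) y) c)⁻¹ * momC r (Φ.flow s z) y l) x :=
    hFm.stronglyMeasurable.integral_prod_right'
  -- on `[0, τ]` it is the time integrand of `T₁`
  have hEq : Set.EqOn (fun s => ∫ x : T3, φ s x / thetaC r (Φ.flow s z) x *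
      ∑ k : Fin 3, ∑ l : Fin 3, devC r (Φ.flow s z) x k l *
        pD k (fun y => (max (rhoC r (Φ.flow s z) y) c)⁻¹ * momC r (Φ.flow s z) y l) x)
      (fun s => ∫ x : T3, φ s x / thetaC r (Φ.flow s z) x *
        ∑ k : Fin 3, ∑ l : Fin 3, devC r (Φ.flow s z) x k l * pD k (fun y => uC r (Φ.flow s z) y l) x)
      (Set.Icc (0 : ℝ) τ) := by
    intro s hs
    have hfl : ∀ y, c ≤ rhoC r (Φ.flow s z) y := fun y => hz.rhoC_ge hs y
    simp only [psvK_uFloor_eq_uC hfl]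
  -- bound on `[0, τ]`
  have hbound : ∀ s ∈ Set.Icc (0 : ℝ) τ, ‖∫ x : T3, φ s x / thetaC r (Φ.flow s z) x *
      ∑ k : Fin 3, ∑ l : Fin 3, devC r (Φ.flow s z) x k l *
        pD k (fun y => (max (rhoC r (Φ.flow s z) y) c)⁻¹ * momC r (Φ.flow s z) y l) x‖ ≤
      Cφ / c * (9 * (8 / (Real.pi * r ^ 3) * ke z * (3 / (Real.pi * r ^ 4) * (1 / 2 + ke z) / c + 3 / (Real.pi * r ^ 3) * (1 / 2 + ke z) * (3 / (Real.pi * r ^ 4)) / c ^ 2))) := by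
    intro s hs
    have hfl : ∀ y, c ≤ rhoC r (Φ.flow s z) y := fun y => hz.rhoC_ge hs y
    simp only [psvK_uFloor_eq_uC hfl]
    refine (norm_integral_le_of_norm_le_const
      (C := Cφ / c * (9 * (8 / (Real.pi * r ^ 3) * ke z * (3 / (Real.pi * r ^ 4) * (1 / 2 + ke z) / c + 3 / (Real.pi * r ^ 3) * (1 / 2 + ke z) * (3 / (Real.pi * r ^ 4)) / c ^ 2))))
      (Eventually.of_forall fun x => ?_)).trans ?_
    · rw [Real.norm_eq_abs, ← ke_flow_eq Φ hz.1 s]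
      exact psvK_abs_T₁_integrand_le hr hc hfl (hz.thetaC_ge hs x) (hφb s hs x)
    · simp
  have hInt : IntegrableOn (fun s => ∫ x : T3, φ s x / thetaC r (Φ.flow s z) x *
      ∑ k : Fin 3, ∑ l : Fin 3, devC r (Φ.flow s z) x k l *
        pD k (fun y => (max (rhoC r (Φ.flow s z) y) c)⁻¹ * momC r (Φ.flow s z) y l) x) (Set.Icc (0 : ℝ) τ) :=
    Measure.integrableOn_of_bounded measure_Icc_lt_top.ne hGm.aestronglyMeasurable
      ((ae_restrict_iff' measurableSet_Icc).2 (Eventually.of_forall hbound))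
  exact hInt.congr_fun hEq measurableSet_Icc

/-- A smooth space–time test function is jointly Borel and continuous in space at each time. -/
theorem psvK_measurable_of_isSmoothSpaceTimeOn {φ : ℝ → T3 → ℝ}
    (hφ : Literature.Analysis.FunctionSpaces.Torus.IsSmoothSpaceTimeOn Set.univ φ) :
    Measurable (Function.uncurry φ) ∧ ∀ s, Continuous (φ s) := by
  have hc : Continuous (Literature.Analysis.FunctionSpaces.Torus.stLift φ) := by
    have h := hφ.continuousOn_stLift
    rw [Set.univ_prod_univ] at h
    exact continuousOn_univ.1 h
  refine ⟨?_, fun s => ?_⟩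
  · have heq : Function.uncurry φ = fun q : ℝ × T3 =>
        Literature.Analysis.FunctionSpaces.Torus.stLift φ
          (q.1, Literature.Analysis.FunctionSpaces.Torus.repr q.2) := by
      funext q
      simp only [Function.uncurry, Literature.Analysis.FunctionSpaces.Torus.stLift_apply,
        Literature.Analysis.FunctionSpaces.Torus.proj_repr]
    rw [heq]
    exact hc.measurable.fun_comp (measurable_fst.prodMk
      (Literature.Analysis.FunctionSpaces.Torus.measurable_repr.fun_comp measurable_snd))
  · have h1 : Continuous fun y : V3 => Literature.Analysis.FunctionSpaces.Torus.stLift φ (s, y) :=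
      hc.comp (continuous_const.prodMk continuous_id)
    exact (Literature.Analysis.FunctionSpaces.Torus.continuous_lift_iff (f := φ s)).1 h1

/-- **`T₁` is an honest double Bochner integral on the regular event.**  For `0 < r`, `0 < c`, a smooth test
function and `z` regular: the time integrand of `T₁` is integrable on `[0, τ]`, and at every `s ∈ [0, τ]` the space
integrand is integrable on `𝕋³` — no junk value is ever taken. -/
theorem psvK_T₁_honest {σ r τ c η₁ : ℝ} (hr : 0 < r) (hc : 0 < c) {Φ : Flow σ N} {z : Phase N}
    (hz : Regular σ r τ c η₁ Φ z) {φ : ℝ → T3 → ℝ}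
    (hφ : Literature.Analysis.FunctionSpaces.Torus.IsSmoothSpaceTimeOn Set.univ φ) :
    IntegrableOn (fun s => ∫ x : T3, φ s x / thetaC r (Φ.flow s z) x *
        ∑ k : Fin 3, ∑ l : Fin 3, devC r (Φ.flow s z) x k l * pD k (fun y => uC r (Φ.flow s z) y l) x)
        (Set.Icc (0 : ℝ) τ) ∧
      ∀ s ∈ Set.Icc (0 : ℝ) τ, Integrable (fun x => φ s x / thetaC r (Φ.flow s z) x *
        ∑ k : Fin 3, ∑ l : Fin 3, devC r (Φ.flow s z) x k l * pD k (fun y => uC r (Φ.flow s z) y l) x) := by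
  obtain ⟨hφm, hφc⟩ := psvK_measurable_of_isSmoothSpaceTimeOn hφ
  obtain ⟨Cφ, hCφ⟩ := hφ.exists_norm_le_of_isCompact isCompact_Icc (Set.subset_univ (Set.Icc (0 : ℝ) τ))
  have hCφ' : ∀ s ∈ Set.Icc (0 : ℝ) τ, ∀ x, |φ s x| ≤ Cφ := fun s hs x => by
    rw [← Real.norm_eq_abs]; exact hCφ s hs x
  exact ⟨psvK_integrableOn_T₁_outer hr hc hz hφm hCφ',
    fun s hs => psvK_integrable_T₁_inner hr hc (fun y => hz.rhoC_ge hs y) (fun y => hz.thetaC_ge hs y)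
      (hφc s)⟩


/-! ## The deterministic core of P1 -/

/-- **Deterministic core of P1.** On a regular orbit (`0 < r`, `0 < c`, `0 ≤ τ`) with weight bound `|φ| ≤ M` and
strain bound `r |∂ₖ u_{r,l}| ≤ K` on `[0,τ] × 𝕋³`:
`|T₁| ≤ (M K/(c r)) ∫₀^τ ∫ ∑ₖₗ |Σ^dev_{kl}|`.  Only the MAJORANT needs honest integrals (`psvK_integrableOn_absDev`):
`norm_integral_le_of_norm_le` is applied at both levels. -/
theorem psvK_abs_T₁_le {σ r τ c η₁ : ℝ} (hr : 0 < r) (hc : 0 < c) (hτ : 0 ≤ τ) {Φ : Flow σ N} {z : Phase N}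
    (hz : Regular σ r τ c η₁ Φ z) {φ : ℝ → T3 → ℝ} {M K : ℝ}
    (hM : ∀ s ∈ Set.Icc (0 : ℝ) τ, ∀ x, |φ s x| ≤ M)
    (hK : ∀ s ∈ Set.Icc (0 : ℝ) τ, ∀ x, ∀ k l : Fin 3,
      r * |pD k (fun y => uC r (Φ.flow s z) y l) x| ≤ K) :
    |T₁ σ r τ φ Φ z| ≤ M * K / (c * r) *
      ∫ s in Set.Icc (0 : ℝ) τ, ∫ x : T3, ∑ k : Fin 3, ∑ l : Fin 3, |devC r (Φ.flow s z) x k l| := by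
  have h0 : (0 : ℝ) ∈ Set.Icc (0 : ℝ) τ := ⟨le_rfl, hτ⟩
  have hM0 : 0 ≤ M := (abs_nonneg _).trans (hM 0 h0 0)
  -- space level: `‖∫ F(s,·)‖ ≤ W ∫ A(s,·)` for `s ∈ [0,τ]`
  have hspace : ∀ s ∈ Set.Icc (0 : ℝ) τ,
      ‖∫ x : T3, φ s x / thetaC r (Φ.flow s z) x *
        ∑ k : Fin 3, ∑ l : Fin 3, devC r (Φ.flow s z) x k l * pD k (fun y => uC r (Φ.flow s z) y l) x‖ ≤
      M * K / (c * r) * ∫ x : T3, ∑ k : Fin 3, ∑ l : Fin 3, |devC r (Φ.flow s z) x k l| := by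
    intro s hs
    set w := Φ.flow s z with hw
    -- the majorant is integrable in `x`: Borel and bounded
    have hAm := fun k l => ((psvK_measurable_devC_uncurry (N := N) r k l).fun_comp
      (measurable_prodMk_left (x := w))).abs
    have hAmeas : Measurable fun x => ∑ k : Fin 3, ∑ l : Fin 3, |devC r w x k l| :=
      Finset.measurable_sum _ fun k _ => Finset.measurable_sum _ fun l _ => hAm k l
    have hAint : Integrable (fun x => M * K / (c * r) * ∑ k : Fin 3, ∑ l : Fin 3, |devC r w x k l|) := by
      refine (Integrable.mono' (integrable_const (9 * (8 / (Real.pi * r ^ 3) * ke w)))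
        hAmeas.aestronglyMeasurable (Eventually.of_forall fun x => ?_)).const_mul _
      rw [Real.norm_eq_abs,
        abs_of_nonneg (Finset.sum_nonneg fun k _ => Finset.sum_nonneg fun l _ => abs_nonneg _)]
      calc _ ≤ ∑ _k : Fin 3, ∑ _l : Fin 3, 8 / (Real.pi * r ^ 3) * ke w :=
            Finset.sum_le_sum fun k _ => Finset.sum_le_sum fun l _ => psvK_abs_devC_le_ke hr w x k l
        _ = _ := by
            simp only [Finset.sum_const, Finset.card_univ, Fintype.card_fin, nsmul_eq_mul, Nat.cast_ofNat]
            ring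
    rw [← integral_const_mul]
    refine norm_integral_le_of_norm_le hAint (Eventually.of_forall fun x => ?_)
    have hθx : c ≤ thetaC r w x := hz.thetaC_ge hs x
    have hθpos : 0 < thetaC r w x := lt_of_lt_of_le hc hθx
    have h1 : |φ s x / thetaC r w x| ≤ M / c := by
      rw [abs_div, abs_of_pos hθpos]; exact div_le_div₀ hM0 (hM s hs x) hc hθx
    have hS : |∑ k : Fin 3, ∑ l : Fin 3, devC r w x k l * pD k (fun y => uC r w y l) x| ≤
        K / r * ∑ k : Fin 3, ∑ l : Fin 3, |devC r w x k l| := by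
      rw [Finset.mul_sum]
      refine (Finset.abs_sum_le_sum_abs _ _).trans (Finset.sum_le_sum fun k _ => ?_)
      rw [Finset.mul_sum]
      refine (Finset.abs_sum_le_sum_abs _ _).trans (Finset.sum_le_sum fun l _ => ?_)
      rw [abs_mul, mul_comm (K / r)]
      refine mul_le_mul_of_nonneg_left ?_ (abs_nonneg _)
      rw [le_div_iff₀ hr, mul_comm]
      exact hK s hs x k l
    rw [Real.norm_eq_abs]
    calc |φ s x / thetaC r w x * ∑ k : Fin 3, ∑ l : Fin 3, devC r w x k l * pD k (fun y => uC r w y l) x|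
        = |φ s x / thetaC r w x| *
            |∑ k : Fin 3, ∑ l : Fin 3, devC r w x k l * pD k (fun y => uC r w y l) x| := abs_mul _ _
      _ ≤ (M / c) * (K / r * ∑ k : Fin 3, ∑ l : Fin 3, |devC r w x k l|) :=
          mul_le_mul h1 hS (abs_nonneg _) (div_nonneg hM0 hc.le)
      _ = M * K / (c * r) * ∑ k : Fin 3, ∑ l : Fin 3, |devC r w x k l| := by
          rw [← mul_assoc, div_mul_div_comm]
  -- time level
  have hAint_s := Integrable.const_mul (psvK_integrableOn_absDev (τ := τ) hr Φ hz.1) (M * K / (c * r))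
  unfold T₁
  rw [abs_neg, ← integral_const_mul]
  have h := norm_integral_le_of_norm_le hAint_s
    ((ae_restrict_iff' measurableSet_Icc).2 (Eventually.of_forall hspace))
  rw [Real.norm_eq_abs] at h
  exact h



/-! ## Registered sub-goals (stmt-AtomisticToContinuum-13081; signatures verbatim) -/

/-- Registered sub-goal `T1_honest_of_regular`: on the regular event both Bochner integrals of `T₁` are honest. -/
theorem T1_honest_of_regular :
  ∀ {N : ℕ} {σ r τ c η₁ : ℝ}, 0 < r → 0 < c → ∀ {Φ : Flow σ N} {z : Phase N}, Regular σ r τ c η₁ Φ z → ∀ {φ : ℝ → T3 → ℝ}, Literature.Analysis.FunctionSpaces.Torus.IsSmoothSpaceTimeOn Set.univ φ → IntegrableOn (fun s => ∫ x : T3, φ s x / thetaC r (Φ.flow s z) x * ∑ k : Fin 3, ∑ l : Fin 3, devC r (Φ.flow s z) x k l * pD k (fun y => uC r (Φ.flow s z) y l) x) (Set.Icc (0 : ℝ) τ) ∧ ∀ s ∈ Set.Icc (0 : ℝ) τ, Integrable (fun x => φ s x / thetaC r (Φ.flow s z) x * ∑ k : Fin 3, ∑ l : Fin 3, devC r (Φ.flow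 s z) x k l * pD k (fun y => uC r (Φ.flow s z) y l) x) :=
  fun hr hc _ _ hz _ hφ => psvK_T₁_honest hr hc hz hφ

/-- Registered sub-goal `abs_T1_le_of_regular`: the deterministic core of P1. -/
theorem abs_T1_le_of_regular :
  ∀ {N : ℕ} {σ r τ c η₁ : ℝ}, 0 < r → 0 < c → 0 ≤ τ → ∀ {Φ : Flow σ N} {z : Phase N}, Regular σ r τ c η₁ Φ z → ∀ {φ : ℝ → T3 → ℝ} {M K : ℝ}, (∀ s ∈ Set.Icc (0 : ℝ) τ, ∀ x, |φ s x| ≤ M) → (∀ s ∈ Set.Icc (0 : ℝ) τ, ∀ x, ∀ k l : Fin 3, r * |pD k (fun y => uC r (Φ.flow s z) y l) x| ≤ K) → |T₁ σ r τ φ Φ z| ≤ M * K / (c * r) * ∫ s in Set.Icc (0 : ℝ) τ, ∫ x : T3, ∑ k : Fin 3, ∑ l : Fin 3, |devC r (Φ.flow s z) x k l| :=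
  fun hr hc hτ _ _ hz _ _ _ hM hK => psvK_abs_T₁_le hr hc hτ hz hM hK

end Summit.AtomisticToContinuum.HydrodynamicLimit.Theorems.LocalSecondLawLedger

end
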